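import Summits.Ventures.PercRepro.MSTightLemma

/-!
# Marica–Schönheim-tight families are connected

`NoSplit F`: every partition of `F` into two nonempty parts has a comparable pair across.
**Theorem 4** (`noSplit_of_tight`, proofs/P4-gen8.md §5): a tight family (`|F \\ F| = |F|`,
equality in Marica–Schönheim) satisfies `NoSplit`. Induction on a support finset `u`, projecting
along an element `r ∈ u` (MSTightProj): when the partner family `K = partner r F` is empty the
projection is a bijection whose comparabilities all lift (a «twisted» pair would put `{r}` into
`F \\ F`, but `∅` is the unique lift of `∅`: `singleton_notMem_diffs`); when `K ≠ ∅`, `K` is tight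
hence connected, `K ∪ (K + r)` is connected, and every other member is comparable to a member of it
by Lemma 3 (`subset_of_diffs_mem`) or its dual (`exists_subset_of_sdiff_mem`), the hypotheses
coming from `mem_diffs_partner_of_both`.
-/

namespace PercRepro.MSTight

open Finset
open scoped FinsetFamily

variable {α : Type*} [DecidableEq α]

/-- **A family cannot be split**: every partition into two nonempty parts has a comparable pair
across (the comparability graph is connected). -/
def NoSplit (F : Finset (Finset α)) : Prop :=
  ∀ s t : Finset (Finset α), s ∪ t = F → Disjoint s t → s.Nonempty → t.Nonempty →
    ∃ a ∈ s, ∃ b ∈ t, a ⊆ b ∨ b ⊆ a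

/-- A family is unsplittable as soon as it contains an unsplittable nonempty sub-family to which
every member is comparable. -/
theorem noSplit_of_attached {F C : Finset (Finset α)} (hC : C ⊆ F)
    (hCns : NoSplit C) (hatt : ∀ A ∈ F, ∃ c ∈ C, A ⊆ c ∨ c ⊆ A) : NoSplit F := by
  intro s t hst hdisj hs ht
  by_cases hsC : (s ∩ C).Nonempty
  · by_cases htC : (t ∩ C).Nonempty
    · -- both parts meet `C`: split `C`
      have hunion : s ∩ C ∪ t ∩ C = C := by
        rw [← Finset.union_inter_distrib_right, hst]
        exact Finset.inter_eq_right.2 hC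
      obtain ⟨a, ha, b, hb, hab⟩ := hCns (s ∩ C) (t ∩ C) hunion
        (Finset.disjoint_of_subset_left Finset.inter_subset_left
          (Finset.disjoint_of_subset_right Finset.inter_subset_left hdisj)) hsC htC
      exact ⟨a, (Finset.mem_inter.1 ha).1, b, (Finset.mem_inter.1 hb).1, hab⟩
    · -- `C ⊆ s`: attach a member of `t`
      obtain ⟨b, hb⟩ := ht
      obtain ⟨c, hc, hbc⟩ := hatt b (hst ▸ Finset.mem_union_right s hb)
      have hcs : c ∈ s := by
        have hcF : c ∈ s ∪ t := hst ▸ hC hc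
        rcases Finset.mem_union.1 hcF with h | h
        · exact h
        · exact absurd ⟨c, Finset.mem_inter.2 ⟨h, hc⟩⟩ htC
      exact ⟨c, hcs, b, hb, hbc.symm⟩
  · -- `C ⊆ t`: attach a member of `s`
    obtain ⟨a, ha⟩ := hs
    obtain ⟨c, hc, hac⟩ := hatt a (hst ▸ Finset.mem_union_left t ha)
    have hct : c ∈ t := by
      have hcF : c ∈ s ∪ t := hst ▸ hC hc
      rcases Finset.mem_union.1 hcF with h | h
      · exact absurd ⟨c, Finset.mem_inter.2 ⟨h, hc⟩⟩ hsC
      · exact h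
    exact ⟨a, ha, c, hct, hac⟩

/-- If `K` is unsplittable and its members avoid `r`, then `K ∪ (K + r)` is unsplittable. -/
theorem noSplit_union_insert {r : α} {K : Finset (Finset α)}
    (hK : NoSplit K) : NoSplit (K ∪ K.image (insert r)) := by
  intro s t hst hdisj hs ht
  by_cases hsplit : ∃ E ∈ K, (E ∈ s ∧ insert r E ∈ t) ∨ (E ∈ t ∧ insert r E ∈ s)
  · obtain ⟨E, -, ⟨h1, h2⟩ | ⟨h1, h2⟩⟩ := hsplit
    · exact ⟨E, h1, insert r E, h2, Or.inl (Finset.subset_insert r E)⟩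
    · exact ⟨insert r E, h2, E, h1, Or.inr (Finset.subset_insert r E)⟩
  · push Not at hsplit
    -- every pair `E, insert r E` lies on one side; split `K` accordingly
    have hmemK : ∀ E ∈ K, E ∈ s ∪ t := fun E hE => hst ▸ Finset.mem_union_left _ hE
    have hmemK' : ∀ E ∈ K, insert r E ∈ s ∪ t := fun E hE =>
      hst ▸ Finset.mem_union_right _ (Finset.mem_image_of_mem _ hE)
    have hside : ∀ E ∈ K, (E ∈ s ↔ insert r E ∈ s) := by
      intro E hE
      constructor
      · intro h
        rcases Finset.mem_union.1 (hmemK' E hE) with h' | h'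
        · exact h'
        · exact absurd h' ((hsplit E hE).1 h)
      · intro h
        rcases Finset.mem_union.1 (hmemK E hE) with h' | h'
        · exact h'
        · exact absurd h ((hsplit E hE).2 h')
    have hunion : K.filter (· ∈ s) ∪ K.filter (· ∈ t) = K := by
      rw [← Finset.filter_or]
      exact Finset.filter_true_of_mem fun E hE => Finset.mem_union.1 (hmemK E hE)
    have hdisj' : Disjoint (K.filter (· ∈ s)) (K.filter (· ∈ t)) := by
      rw [Finset.disjoint_left]
      intro E h1 h2
      exact Finset.disjoint_left.1 hdisj (Finset.mem_filter.1 h1).2 (Finset.mem_filter.1 h2).2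
    have hsne : (K.filter (· ∈ s)).Nonempty := by
      obtain ⟨a, ha⟩ := hs
      rcases Finset.mem_union.1 (hst ▸ Finset.mem_union_left t ha : a ∈ K ∪ K.image (insert r))
        with h | h
      · exact ⟨a, Finset.mem_filter.2 ⟨h, ha⟩⟩
      · obtain ⟨E, hE, rfl⟩ := Finset.mem_image.1 h
        exact ⟨E, Finset.mem_filter.2 ⟨hE, (hside E hE).2 ha⟩⟩
    have htne : (K.filter (· ∈ t)).Nonempty := by
      obtain ⟨b, hb⟩ := ht
      rcases Finset.mem_union.1 (hst ▸ Finset.mem_union_right s hb : b ∈ K ∪ K.image (insert r))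
        with h | h
      · exact ⟨b, Finset.mem_filter.2 ⟨h, hb⟩⟩
      · obtain ⟨E, hE, rfl⟩ := Finset.mem_image.1 h
        have : E ∈ t := by
          rcases Finset.mem_union.1 (hmemK E hE) with h' | h'
          · exact absurd hb ((hsplit E hE).1 h')
          · exact h'
        exact ⟨E, Finset.mem_filter.2 ⟨hE, this⟩⟩
    obtain ⟨a, ha, b, hb, hab⟩ := hK _ _ hunion hdisj' hsne htne
    exact ⟨a, (Finset.mem_filter.1 ha).2, b, (Finset.mem_filter.1 hb).2, hab⟩

/-- In a tight family with empty partner family, comparabilities lift from the projection: if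
`a.erase r ⊆ b.erase r` for members `a, b` then `a ⊆ b`. -/
theorem subset_of_erase_subset {r : α} {F : Finset (Finset α)} (hF : Tight F)
    (hK : partner r F = ∅) {a b : Finset α} (ha : a ∈ F) (hb : b ∈ F)
    (h : a.erase r ⊆ b.erase r) : a ⊆ b := by
  by_cases hra : r ∈ a
  · by_cases hrb : r ∈ b
    · rw [← Finset.insert_erase hra, ← Finset.insert_erase hrb]
      exact Finset.insert_subset_insert r h
    · -- twisted: `a \ b = {r}` would be a difference
      exfalso
      have hab : a \ b = {r} := by
        ext x
        simp only [Finset.mem_sdiff, Finset.mem_singleton]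
        constructor
        · rintro ⟨hxa, hxb⟩
          by_contra hxr
          exact hxb ((Finset.mem_erase.1 (h (Finset.mem_erase.2 ⟨hxr, hxa⟩))).2)
        · rintro rfl
          exact ⟨hra, hrb⟩
      exact singleton_notMem_diffs hF hK ⟨a, ha⟩ (hab ▸ Finset.mem_diffs.2 ⟨a, ha, b, hb, rfl⟩)
  · rw [← Finset.erase_eq_of_notMem hra]
    exact h.trans (Finset.erase_subset r b)

/-- In a tight family with empty partner family the projection is injective on members. -/
theorem erase_injOn_of_partner_eq_empty {r : α} {F : Finset (Finset α)}
    (hK : partner r F = ∅) {a b : Finset α} (ha : a ∈ F) (hb : b ∈ F)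
    (h : a.erase r = b.erase r) : a = b := by
  by_cases hra : r ∈ a <;> by_cases hrb : r ∈ b
  · rw [← Finset.insert_erase hra, ← Finset.insert_erase hrb, h]
  · exfalso
    have : b ∈ partner r F := by
      rw [partner, Finset.mem_inter, mem_part0, mem_partr]
      refine ⟨⟨hb, hrb⟩, hrb, ?_⟩
      rw [← Finset.erase_eq_of_notMem hrb, ← h, Finset.insert_erase hra]
      exact ha
    rw [hK] at this
    exact Finset.notMem_empty b this
  · exfalso
    have : a ∈ partner r F := by
      rw [partner, Finset.mem_inter, mem_part0, mem_partr]
      refine ⟨⟨ha, hra⟩, hra, ?_⟩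
      rw [← Finset.erase_eq_of_notMem hra, h, Finset.insert_erase hrb]
      exact hb
    rw [hK] at this
    exact Finset.notMem_empty a this
  · rw [← Finset.erase_eq_of_notMem hra, ← Finset.erase_eq_of_notMem hrb, h]

/-- **Theorem 4: a tight family is connected** (`NoSplit`). -/
theorem noSplit_of_tight (u : Finset α) :
    ∀ F : Finset (Finset α), (∀ A ∈ F, A ⊆ u) → Tight F → NoSplit F := by
  induction u using Finset.strongInduction with
  | H u ih =>
    intro F hFu hF s t hst hdisj hs ht
    rcases Finset.eq_empty_or_nonempty u with hu | ⟨r, hru⟩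
    · -- every member is empty
      obtain ⟨a, ha⟩ := hs
      obtain ⟨b, hb⟩ := ht
      refine ⟨a, ha, b, hb, Or.inl ?_⟩
      have := hFu a (hst ▸ Finset.mem_union_left t ha)
      rw [hu, Finset.subset_empty] at this
      rw [this]
      exact Finset.empty_subset b
    have hlt : u.erase r ⊂ u := Finset.erase_ssubset hru
    have hFne : F.Nonempty := by
      obtain ⟨a, ha⟩ := hs
      exact ⟨a, hst ▸ Finset.mem_union_left t ha⟩
    rcases Finset.eq_empty_or_nonempty (partner r F) with hK | hKne
    · -- CASE A: the projection is an order-isomorphism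
      have hF' : Tight (proj r F) := (tight_proj_and_partner hF).1
      have hFu' : ∀ A ∈ proj r F, A ⊆ u.erase r := by
        intro A hA
        obtain ⟨B, hB, rfl⟩ := mem_proj.1 hA
        exact Finset.erase_subset_erase r (hFu B hB)
      have hns' := ih (u.erase r) hlt (proj r F) hFu' hF'
      have hsF : s ⊆ F := hst ▸ Finset.subset_union_left
      have htF : t ⊆ F := hst ▸ Finset.subset_union_right
      have hunion : s.image (·.erase r) ∪ t.image (·.erase r) = proj r F := by
        rw [← Finset.image_union, hst, proj]
      have hdisj' : Disjoint (s.image (·.erase r)) (t.image (·.erase r)) := by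
        rw [Finset.disjoint_left]
        intro E hE hE'
        obtain ⟨a, ha, rfl⟩ := Finset.mem_image.1 hE
        obtain ⟨b, hb, hab⟩ := Finset.mem_image.1 hE'
        have : b = a := erase_injOn_of_partner_eq_empty hK (htF hb) (hsF ha) hab
        exact Finset.disjoint_left.1 hdisj ha (this ▸ hb)
      obtain ⟨a', ha', b', hb', hab'⟩ := hns' _ _ hunion hdisj' (hs.image _) (ht.image _)
      obtain ⟨a, ha, rfl⟩ := Finset.mem_image.1 ha'
      obtain ⟨b, hb, rfl⟩ := Finset.mem_image.1 hb'
      refine ⟨a, ha, b, hb, ?_⟩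
      rcases hab' with h | h
      · exact Or.inl (subset_of_erase_subset hF hK (hsF ha) (htF hb) h)
      · exact Or.inr (subset_of_erase_subset hF hK (htF hb) (hsF ha) h)
    · -- CASE B: the partner family is a connected core to which every member is comparable
      have hKt : Tight (partner r F) := (tight_proj_and_partner hF).2.1
      have hKu : ∀ E ∈ partner r F, E ⊆ u.erase r := fun E hE =>
        Finset.subset_erase.2 ⟨hFu E (mem_part0.1 (Finset.mem_inter.1 hE).1).1,
          not_mem_of_mem_partner hE⟩
      have hKns : NoSplit (partner r F) := ih (u.erase r) hlt _ hKu hKt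
      have hKF : partner r F ⊆ F := fun E hE => (mem_part0.1 (Finset.mem_inter.1 hE).1).1
      have hKrF : (partner r F).image (insert r) ⊆ F := by
        intro A hA
        obtain ⟨E, hE, rfl⟩ := Finset.mem_image.1 hA
        exact (mem_partr.1 (Finset.mem_inter.1 hE).2).2
      have hCF : partner r F ∪ (partner r F).image (insert r) ⊆ F := Finset.union_subset hKF hKrF
      have hCns : NoSplit (partner r F ∪ (partner r F).image (insert r)) :=
        noSplit_union_insert hKns
      refine noSplit_of_attached hCF hCns ?_ s t hst hdisj hs ht
      intro A hA
      by_cases hrA : r ∈ A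
      · -- `A = insert r P`; `P \ E ∈ K \\ K` for all `E ∈ K`, so `P ⊆ E` for some `E`
        by_cases hP : A.erase r ∈ partner r F
        · refine ⟨insert r (A.erase r), Finset.mem_union_right _ (Finset.mem_image_of_mem _ hP),
            Or.inl ?_⟩
          rw [Finset.insert_erase hrA]
        · have hdiff : ∀ E ∈ partner r F, A.erase r \ E ∈ partner r F \\ partner r F := by
            intro E hE
            have hrE : r ∉ E := not_mem_of_mem_partner hE
            have hEF : E ∈ F := hKF hE
            have hErF : insert r E ∈ F := (mem_partr.1 (Finset.mem_inter.1 hE).2).2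
            refine mem_diffs_partner_of_both hF (fun h => Finset.notMem_erase r A
              (Finset.mem_sdiff.1 h).1) ?_ ?_
            · refine Finset.mem_diffs.2 ⟨A, hA, insert r E, hErF, ?_⟩
              rw [Finset.sdiff_insert, Finset.erase_sdiff_comm]
            · refine Finset.mem_diffs.2 ⟨A, hA, E, hEF, ?_⟩
              rw [Finset.erase_sdiff_comm, Finset.insert_erase (Finset.mem_sdiff.2 ⟨hrA, hrE⟩)]
          obtain ⟨E, hE, hPE⟩ := subset_of_diffs_mem (u.erase r) (partner r F) (A.erase r) hKu
            (Finset.erase_subset_erase r (hFu A hA)) hKne hKt hdiff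
          refine ⟨insert r E, Finset.mem_union_right _ (Finset.mem_image_of_mem _ hE), Or.inl ?_⟩
          rw [← Finset.insert_erase hrA]
          exact Finset.insert_subset_insert r hPE
      · by_cases hAK : A ∈ partner r F
        · exact ⟨A, Finset.mem_union_left _ hAK, Or.inl subset_rfl⟩
        · -- `E \ A ∈ K \\ K` for all `E ∈ K`, so `E ⊆ A` for some `E`
          have hdiff : ∀ E ∈ partner r F, E \ A ∈ partner r F \\ partner r F := by
            intro E hE
            have hrE : r ∉ E := not_mem_of_mem_partner hE
            have hEF : E ∈ F := hKF hE
            have hErF : insert r E ∈ F := (mem_partr.1 (Finset.mem_inter.1 hE).2).2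
            refine mem_diffs_partner_of_both hF (fun h => hrE (Finset.mem_sdiff.1 h).1)
              (Finset.mem_diffs.2 ⟨E, hEF, A, hA, rfl⟩) ?_
            refine Finset.mem_diffs.2 ⟨insert r E, hErF, A, hA, ?_⟩
            rw [Finset.insert_sdiff_of_notMem _ hrA]
          obtain ⟨E, hE, hEA⟩ := exists_subset_of_sdiff_mem (u.erase r) (partner r F) A hKu
            (Finset.subset_erase.2 ⟨hFu A hA, hrA⟩) hKne hKt hdiff
          exact ⟨E, Finset.mem_union_left _ hE, Or.inr hEA⟩

end PercRepro.MSTight
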